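/-
Copyright (c) 2026. Released under Apache 2.0 license.

# CDT (4.3.3): the Eisenstein witness `G₁₂^{(a,0)}/Δ ∈ M_N`

For the degree lower bound `[M_N : M_2] ≥ c N³` [CalegariDimitrovTang2025, (4.3.3)] one needs
explicit elements of `M_N` (generators `F/Δᵐ`, `F ∈ M_{12m}(Γ(N))` with INTEGRAL `q_N`-expansion)
with small stabiliser.  The Eisenstein series over a congruence class,
`G_k^{a}(τ) = Σ_{x ≡ a (N)} (x₀τ + x₁)^{-k}` (the tree's `latticeEisensteinMF`, with its
`q_N`-expansion `qExpansion_coeff_latticeEisensteinMF` [DiamondShurman2005, Thm. 4.2.3]), provides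
them: for `a = (a₀, 0)`, `a₀ ≢ 0`, the normalised series `(N^k (k-1)!/(-2πi)^k) · G_k^{(a₀,0)}` has
integer Fourier coefficients `Σ_{cm = n, c ≡ ±a₀ (N)} m^{k-1}` and zero constant term; and for
`N ≥ 3`, `k` even, `G_k^{b} = G_k^{(1,0)}` forces `b = ±(1,0)` (compare the coefficients of `q_N`).
-/
import Literature.NumberTheory.ModularForms.EisensteinLatticeCosetQExpansion
import Literature.NumberTheory.Automorphic.UnboundedDenominatorsFields
import HarnessLib

open Complex Real Filter Topology Function Metric Set
open UpperHalfPlane hiding I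
open scoped Real Topology Manifold MatrixGroups ModularForm

namespace Literature.NumberTheory.Automorphic

namespace UnboundedDenominators

open _root_.Complex ModularGroup CongruenceSubgroup Matrix.SpecialLinearGroup
  Literature.NumberTheory.ModularForms EisensteinSeries

/-! ### The weights and coefficients for `a = (a₀, 0)` -/

/-- For `a = (a₀, 0)` the root-of-unity weights of `G_k^a` are the integers
`[c ≡ a₀] + (-1)^k [c ≡ -a₀]`. [cite: DiamondShurman2005, Thm. 4.2.3] -/
theorem latticeEisensteinWeight_snd_zero (N k : ℕ) (a₀ : ZMod N) (c m : ℕ) :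
    latticeEisensteinWeight N k ![a₀, 0] c m =
      (if ((c : ZMod N)) = a₀ then 1 else 0) + (-1) ^ k * (if ((c : ZMod N)) = -a₀ then 1 else 0) := by
  simp [latticeEisensteinWeight, ZMod.val_zero]

/-- For `a = (a₀, 0)` with `a₀ ≠ 0` and `n ≠ 0`... the `n`-th coefficient of `G_k^{(a₀,0)}` is
`(N^k)⁻¹ C_k` times an INTEGER, namely `Σ_{cm = n} ([c ≡ a₀] + (-1)^k[c ≡ -a₀]) m^{k-1}`; the constant
term vanishes. [cite: DiamondShurman2005, Thm. 4.2.3] -/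
theorem exists_int_latticeEisensteinCoeff_snd_zero (N k : ℕ) {a₀ : ZMod N} (ha₀ : a₀ ≠ 0) (n : ℕ) :
    ∃ z : ℤ, latticeEisensteinCoeff N k ![a₀, 0] n =
      ((N : ℂ) ^ k)⁻¹ * ((-2 * π * Complex.I) ^ k / (k - 1).factorial) * (z : ℂ) := by
  classical
  rcases eq_or_ne n 0 with rfl | hn
  · refine ⟨0, ?_⟩
    simp [latticeEisensteinCoeff, ha₀]
  · refine ⟨∑ p ∈ n.divisorsAntidiagonal,
      ((if ((p.1 : ZMod N)) = a₀ then 1 else 0) + (-1) ^ k * (if ((p.1 : ZMod N)) = -a₀ then 1 else 0)) *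
        (p.2 : ℤ) ^ (k - 1), ?_⟩
    rw [latticeEisensteinCoeff, if_neg hn]
    congr 1
    push_cast
    refine Finset.sum_congr rfl fun p _ ↦ ?_
    rw [latticeEisensteinWeight_snd_zero]

/-! ### The normalised Eisenstein series is a generator of `M_N` -/

/-- **The Eisenstein witness in `M_N`.**  For `N ≥ 1`, `m ≥ 1` and `a₀ ∈ ℤ/N`, `a₀ ≠ 0`, the
normalised Eisenstein series `F = (N^{12m} (12m-1)!/(-2πi)^{12m}) · G_{12m}^{(a₀,0)} ∈ M_{12m}(Γ(N))`
has rational-integer Fourier coefficients at the period `N` (and zero constant term), so that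
`F/Δᵐ` is one of the generators `levelGens N` of CDT's field `M_N`; as a function,
`F = (N^{12m} (12m-1)!/(-2πi)^{12m}) · latticeEisenstein N (12m) (a₀, 0)`.
[cite: CalegariDimitrovTang2025, Definition 4.2.1 and (4.3.3)] -/
theorem exists_latticeEisenstein_mem_levelGens (N : ℕ) [NeZero N] {m : ℕ} (hm : 0 < m)
    {a₀ : ZMod N} (ha₀ : a₀ ≠ 0) :
    ∃ F : ModularForm ((Gamma N : Subgroup SL(2, ℤ)) : Subgroup (GL (Fin 2) ℝ)) (12 * (m : ℤ)),
      (F : ℍ → ℂ) = ((N : ℂ) ^ (12 * m) * ((12 * m - 1).factorial : ℂ) / (-2 * π * Complex.I) ^ (12 * m)) •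
          latticeEisenstein N (12 * (m : ℤ)) ![a₀, 0] ∧
      (∀ n : ℕ, ∃ z : ℤ, PowerSeries.coeff n (qExpansion (N : ℝ) F) = (z : ℂ)) ∧
      PowerSeries.coeff 0 (qExpansion (N : ℝ) F) = 0 ∧
      algebraMap hol Mer (modFun m F) ∈ levelGens N := by
  classical
  have hk : (3 : ℤ) ≤ 12 * (m : ℤ) := by omega
  set c : ℂ := (N : ℂ) ^ (12 * m) * ((12 * m - 1).factorial : ℂ) / (-2 * π * Complex.I) ^ (12 * m)
    with hc
  set F₀ : ModularForm ((Gamma N : Subgroup SL(2, ℤ)) : Subgroup (GL (Fin 2) ℝ)) (12 * (m : ℤ)) :=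
    latticeEisensteinMF N hk ![a₀, 0] with hF₀
  set F := c • F₀ with hF
  have hFcoe : (F : ℍ → ℂ) = c • latticeEisenstein N (12 * (m : ℤ)) ![a₀, 0] := by
    rw [hF, ModularForm.IsGLPos.coe_smul, hF₀, coe_latticeEisensteinMF]
  -- the `q_N`-expansion of `F₀`, transported from the `ℕ`-weight statement
  have hkN : 3 ≤ 12 * m := by omega
  have hcoeF₀ : (F₀ : ℍ → ℂ) =
      ⇑(latticeEisensteinMF N (k := ((12 * m : ℕ) : ℤ)) (by exact_mod_cast hkN) ![a₀, 0]) := by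
    rw [hF₀, coe_latticeEisensteinMF, coe_latticeEisensteinMF]
    push_cast
    rfl
  have hq₀ : ∀ n, PowerSeries.coeff n (qExpansion (N : ℝ) F₀) =
      latticeEisensteinCoeff N (12 * m) ![a₀, 0] n := by
    intro n
    rw [hcoeF₀]
    exact qExpansion_coeff_latticeEisensteinMF N (12 * m) ![a₀, 0] hkN n
  -- `qExpansion (c • F₀) = c • qExpansion F₀`
  have hN0 : (0 : ℝ) < N := by exact_mod_cast NeZero.pos N
  have hper : ((N : ℕ) : ℝ) ∈ ((Gamma N : Subgroup SL(2, ℤ)) : Subgroup (GL (Fin 2) ℝ)).strictPeriods := by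
    rw [CongruenceSubgroup.strictPeriods_Gamma]
    exact AddSubgroup.mem_zmultiples _
  have hqF : qExpansion (N : ℝ) F = c • qExpansion (N : ℝ) F₀ := by
    rw [hF, ModularForm.IsGLPos.coe_smul]
    exact qExpansion_smul (ModularFormClass.analyticAt_cuspFunction_zero F₀ hN0 hper) c
  have hC : ((N : ℂ) ^ (12 * m))⁻¹ * ((-2 * π * Complex.I) ^ (12 * m) / ((12 * m - 1).factorial : ℂ)) * c
      = 1 := by
    have h1 : (N : ℂ) ^ (12 * m) ≠ 0 := pow_ne_zero _ (by exact_mod_cast NeZero.ne N)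
    have h2 : (-2 * π * Complex.I) ^ (12 * m) ≠ 0 := by
      apply pow_ne_zero
      simp [Real.pi_ne_zero, Complex.I_ne_zero]
    have h3 : ((12 * m - 1).factorial : ℂ) ≠ 0 := by exact_mod_cast Nat.factorial_ne_zero _
    rw [hc]
    field_simp
  have hcoeff : ∀ n : ℕ, ∃ z : ℤ, PowerSeries.coeff n (qExpansion (N : ℝ) F) = (z : ℂ) := by
    intro n
    obtain ⟨z, hz⟩ := exists_int_latticeEisensteinCoeff_snd_zero N (12 * m) ha₀ n
    refine ⟨z, ?_⟩
    rw [hqF, PowerSeries.coeff_smul, hq₀, hz, smul_eq_mul]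
    have e : (((12 * m : ℕ) - 1 : ℕ) : ℂ) = ((12 * m - 1).factorial : ℂ) ∨ True := Or.inr trivial
    calc c * (((N : ℂ) ^ (12 * m))⁻¹ * ((-2 * π * Complex.I) ^ (12 * m) / ((12 * m - 1).factorial : ℂ))
          * (z : ℂ))
        = (((N : ℂ) ^ (12 * m))⁻¹ * ((-2 * π * Complex.I) ^ (12 * m) / ((12 * m - 1).factorial : ℂ))
          * c) * z := by ring
      _ = z := by rw [hC, one_mul]
  have hcoeff0 : PowerSeries.coeff 0 (qExpansion (N : ℝ) F) = 0 := by
    rw [hqF, PowerSeries.coeff_smul, hq₀, smul_eq_mul]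
    simp [latticeEisensteinCoeff, ha₀]
  refine ⟨F, hFcoe, hcoeff, hcoeff0, ?_⟩
  exact ⟨Gamma N, inferInstance, m, F, le_rfl, hcoeff, rfl⟩

/-! ### Distinct classes give distinct series: the coefficient of `q_N` -/

/-- The first Fourier coefficient of `G_k^{b}`: `(N^k)⁻¹ C_k · w_b(1, 1)` with
`w_b(1,1) = [b₀ = 1] ζ_N^{b₁} + (-1)^k [b₀ = -1] ζ_N^{-b₁}`. [cite: DiamondShurman2005, Thm. 4.2.3] -/
theorem latticeEisensteinCoeff_one (N k : ℕ) (b : Fin 2 → ZMod N) :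
    latticeEisensteinCoeff N k b 1 =
      ((N : ℂ) ^ k)⁻¹ * ((-2 * π * Complex.I) ^ k / (k - 1).factorial) *
        latticeEisensteinWeight N k b 1 1 := by
  rw [latticeEisensteinCoeff, if_neg one_ne_zero, Nat.divisorsAntidiagonal_one]
  simp

/-- `e^{2πi t/N} = 1` with `0 ≤ t < N` forces `t = 0`. [folklore] -/
private theorem val_eq_zero_of_cexp_eq_one {N : ℕ} [NeZero N] {t : ZMod N}
    (h : cexp (2 * π * Complex.I * ((t.val : ℂ) * 1) / N) = 1) : t = 0 := by
  rw [Complex.exp_eq_one_iff] at h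
  obtain ⟨n, hn⟩ := h
  have hN : (N : ℂ) ≠ 0 := by exact_mod_cast NeZero.ne N
  have h2 : (2 * π * Complex.I) ≠ 0 := by simp [Real.pi_ne_zero, Complex.I_ne_zero]
  have ht : (t.val : ℂ) = n * N := by
    field_simp at hn
    linear_combination hn
  have ht' : (t.val : ℤ) = n * N := by exact_mod_cast ht
  have hlt : t.val < N := ZMod.val_lt t
  have h0 : (t.val : ℤ) = 0 := by
    rcases lt_trichotomy n 0 with hn0 | rfl | hn0
    · have : (t.val : ℤ) < 0 := by
        rw [ht']; exact mul_neg_of_neg_of_pos (by exact_mod_cast hn0) (by exact_mod_cast NeZero.pos N)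
      omega
    · simp [ht']
    · have : (N : ℤ) ≤ t.val := by
        rw [ht']; nlinarith [(by exact_mod_cast NeZero.pos N : (0 : ℤ) < N)]
      omega
  have : t.val = 0 := by exact_mod_cast h0
  exact (ZMod.val_eq_zero t).mp this

/-- **`G_k^{b} = G_k^{(1,0)}` forces `b = ±(1,0)`** (`N ≥ 3`, `k ≥ 3` even): compare the
coefficients of `q_N` — `[b₀ = 1] ζ_N^{b₁} + [b₀ = -1] ζ_N^{-b₁}` against `1`.  This is what makes the
stabiliser of the witness `G₁₂^{(1,0)}/Δ` in `SL₂(ℤ)` reduce to `{γ : (γ₀₀, γ₀₁) ≡ ±(1, 0) (N)}`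
(`G^{a} ∣ γ = G^{aγ}`, `latticeEisensteinMF_slash`).
[cite: CalegariDimitrovTang2025, §4.2, (4.3.3)] -/
theorem latticeEisenstein_eq_one_zero_imp {N : ℕ} [NeZero N] (hN : 3 ≤ N) {k : ℕ} (hk : 3 ≤ k)
    (heven : Even k) {b : Fin 2 → ZMod N}
    (h : (⇑(latticeEisensteinMF N (k := (k : ℤ)) (by exact_mod_cast hk) b) : ℍ → ℂ) =
      ⇑(latticeEisensteinMF N (k := (k : ℤ)) (by exact_mod_cast hk) ![1, 0])) :
    b = ![1, 0] ∨ b = ![-1, 0] := by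
  classical
  have hq : PowerSeries.coeff 1 (qExpansion (N : ℝ)
      (⇑(latticeEisensteinMF N (k := (k : ℤ)) (by exact_mod_cast hk) b))) =
      PowerSeries.coeff 1 (qExpansion (N : ℝ)
        (⇑(latticeEisensteinMF N (k := (k : ℤ)) (by exact_mod_cast hk) ![1, 0]))) := by rw [h]
  rw [qExpansion_coeff_latticeEisensteinMF N k b hk 1, qExpansion_coeff_latticeEisensteinMF N k _ hk 1,
    latticeEisensteinCoeff_one, latticeEisensteinCoeff_one] at hq
  have hC : ((N : ℂ) ^ k)⁻¹ * ((-2 * π * Complex.I) ^ k / (k - 1).factorial) ≠ 0 := by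
    have h1 : (N : ℂ) ^ k ≠ 0 := pow_ne_zero _ (by exact_mod_cast NeZero.ne N)
    have h2 : (-2 * π * Complex.I) ^ k ≠ 0 := by
      apply pow_ne_zero; simp [Real.pi_ne_zero, Complex.I_ne_zero]
    have h3 : ((k - 1).factorial : ℂ) ≠ 0 := by exact_mod_cast Nat.factorial_ne_zero _
    exact mul_ne_zero (inv_ne_zero h1) (div_ne_zero h2 h3)
  have hw := mul_left_cancel₀ hC hq
  -- in `ℤ/N`, `N ≥ 3`: `1 ≠ -1`
  have h1ne : (1 : ZMod N) ≠ -1 := by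
    intro h1
    have h2 : (2 : ZMod N) = 0 := by linear_combination h1
    have : ((2 : ℕ) : ZMod N) = 0 := by exact_mod_cast h2
    rw [ZMod.natCast_eq_zero_iff] at this
    exact absurd (Nat.le_of_dvd two_pos this) (by omega)
  have hR : latticeEisensteinWeight N k ![1, 0] 1 1 = 1 := by
    simp [latticeEisensteinWeight, h1ne, ZMod.val_zero]
  rw [hR] at hw
  simp only [latticeEisensteinWeight, Nat.cast_one, heven.neg_one_pow, one_mul] at hw
  by_cases hb0 : (1 : ZMod N) = b 0
  · have hb0' : ¬ (1 : ZMod N) = -b 0 := by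
      intro h'
      exact h1ne (h'.trans (by rw [← hb0]))
    rw [if_pos hb0, if_neg hb0', add_zero] at hw
    have hb1 : b 1 = 0 := val_eq_zero_of_cexp_eq_one hw
    left
    funext i; fin_cases i
    · exact hb0.symm
    · exact hb1
  · by_cases hb0' : (1 : ZMod N) = -b 0
    · rw [if_neg hb0, if_pos hb0', zero_add] at hw
      have hw' : cexp (2 * π * Complex.I * (((b 1).val : ℂ) * 1) / N) = 1 := by
        have := congrArg (·⁻¹) hw
        simpa [← Complex.exp_neg, neg_div, neg_neg] using this
      have hb1 : b 1 = 0 := val_eq_zero_of_cexp_eq_one hw'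
      right
      funext i; fin_cases i
      · show b 0 = -1
        rw [← neg_neg (b 0), ← hb0']
      · exact hb1
    · rw [if_neg hb0, if_neg hb0', add_zero] at hw
      exact absurd hw zero_ne_one

end UnboundedDenominators

end Literature.NumberTheory.Automorphic
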